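import Summits.CriticalPhenomena.CardyFormulaZ2.Theses.CardyRotToConf
import Summits.CriticalPhenomena.CardyFormulaZ2.Theorems.CardyRotToConfR2SymmetryUpgrade.Negative.CurveTransport
import Summits.CriticalPhenomena.CardyFormulaZ2.Theorems.CardyRotToConfR2SymmetryUpgrade.Negative.CruxConsequences
import Literature.Probability.RandomPlanarGeometry.SLEUniquenessInLaw

/-!
# `CardyRotToConfR2SymmetryUpgrade` (stmt-CriticalPhenomena-0698): reflection symmetry of the
# typed hypothesis bundle, and the chirality refutation template

By-product of the cdisprove unit (standing adversary), part 2 of 2, for provers, planners and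
future refuters of the crux `∀ P, IsLocalMarkovChordalFamily P → (non-tracing) → ∀ D,
IsSLELaw 6 D (P D)`.

The bundle `IsLocalMarkovChordalFamily` asks for covariance under ORIENTATION-PRESERVING
similarities only. Nevertheless all five axioms and the non-tracing clause are invariant under the
**conjugation transport** `P̄ D := conj_* (P (conj D))` (written out in full; transports
`isChordal_conjTransport`, `nonTracing_conjTransport`, `isSimilarityCovariant_conjTransport`,
`isLocal_conjTransport`, `isTargetIndependent_conjTransport`, `isDomainMarkov_conjTransport`,
`isLocalMarkovChordalFamily_conjTransport`). Consequences:

* `eq_of_crux` — under the crux any two admissible families coincide (`IsSLELaw.unique'`);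
* `conjTransport_eq_of_crux`, `conj_covariant_of_crux`, `isLatticeSimilarityCovariant_of_crux` —
  under the crux every admissible family is ACHIRAL, `P̄ = P`, i.e. satisfies the conjugation
  clause `P (conj D) = conj_* (P D)` of `ChordalFamily.IsLatticeSimilarityCovariant`: a testable
  strengthened corollary (positive lines that need reflection covariance / colour-flip symmetry
  must derive it);
* `not_crux_of_chiral`, `not_crux_of_not_conj_covariant` — ONE admissible family with
  `P̄ D ≠ P D` for ONE `D` refutes the crux; no fact about SLE₆ (not even existence) and no
  second family is needed. Every junk candidate on record (bisector explorers with `c ≠ 1/2`,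
  normal-chord families, germ-label transport with a chiral label) is chiral.

Maintenance record (full-build repair, 2026-08-17; dependency drift, content unchanged). The crux was
REFUTED on 2026-08-16 (`Theorems.not_CardyRotToConfR2SymmetryUpgrade`, p129826; stmt-0698 closed
`refuted`) and route rev 17 dropped the decl `…Theses.CardyRotToConf.CardyRotToConfR2SymmetryUpgrade`,
which the `…_of_crux` / `not_crux_…` theorems below name through `open …Theses.CardyRotToConf`. The
refuted statement is recorded VERBATIM under that former name in the sibling
`Negative/CruxConsequences.lean` (p134753); this file now imports it, so every signature and proof below
is byte-for-byte the landed one — the only change is that import.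
-/

noncomputable section

open Set MeasureTheory Topology Filter
open scoped unitInterval ENNReal NNReal ComplexConjugate

namespace Summit.CriticalPhenomena.CardyFormulaZ2.Theorems.CardyRotToConfR2SymmetryUpgrade.Negative

open Literature.Probability.RandomPlanarGeometry
open Literature.Probability.RandomPlanarGeometry.ChordalFamily
open Summit.CriticalPhenomena.CardyFormulaZ2.Theses.CardyRotToConf
open Complex (conjLIE conj_conj)

/-- **Two-family template.** Under the crux any two admissible families coincide on every
Dobrushin domain (both laws are SLE₆ laws of `(D; a, b)`; `IsSLELaw.unique'`). [folklore] -/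
theorem eq_of_crux (h : CardyRotToConfR2SymmetryUpgrade) {P₁ P₂ : ChordalFamily}
    (h₁ : IsLocalMarkovChordalFamily P₁)
    (n₁ : ∀ D : DobrushinDomain, ∀ᵐ γ ∂(P₁ D), ∀ c : Curve ℂ, CurveClass.mk c = γ →
      ∀ s t : unitInterval, s < t → c '' Set.Icc s t ⊆ frontier D.carrier →
        (c '' Set.Icc s t).Subsingleton)
    (h₂ : IsLocalMarkovChordalFamily P₂)
    (n₂ : ∀ D : DobrushinDomain, ∀ᵐ γ ∂(P₂ D), ∀ c : Curve ℂ, CurveClass.mk c = γ →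
      ∀ s t : unitInterval, s < t → c '' Set.Icc s t ⊆ frontier D.carrier →
        (c '' Set.Icc s t).Subsingleton)
    (D : DobrushinDomain) : P₁ D = P₂ D :=
  (h P₁ h₁ n₁ D).unique' (h P₂ h₂ n₂ D)

/-! ### The transported family and the transport of each axiom -/

/-! The **conjugation transport** of a chordal family `P` is the family
`P̄ := fun D => (P (D.map conj)).map (CurveClass.map conj)`, i.e. `P̄ D = conj_* (P (conj D))`, the
mirror image of `P`. It is written out in full below (no auxiliary definition), with
`conj = Complex.conjLIE.toHomeomorph`. -/

/-- The transported law of a set is the original law of its `conj_*`-preimage (no measurability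
needed: `conj_*` is a measurable embedding). [folklore] -/
theorem conjTransport_apply (P : ChordalFamily) (D : DobrushinDomain)
    (A : Set (CurveClass ℂ)) :
    (P (D.map conjLIE.toHomeomorph)).map (CurveClass.map (conjLIE.toHomeomorph : C(ℂ, ℂ))) A =
      P (D.map conjLIE.toHomeomorph) (CurveClass.map (conjLIE.toHomeomorph : C(ℂ, ℂ)) ⁻¹' A) := by
  rw [measurableEmbedding_curveClassMap_conj.map_apply]

/-- Almost-sure statements transfer through the transport. [folklore] -/
theorem ae_conjTransport_iff {P : ChordalFamily} {D : DobrushinDomain}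
    {q : CurveClass ℂ → Prop} :
    (∀ᵐ γ ∂((P (D.map conjLIE.toHomeomorph)).map
        (CurveClass.map (conjLIE.toHomeomorph : C(ℂ, ℂ)))), q γ) ↔
      ∀ᵐ γ ∂(P (D.map conjLIE.toHomeomorph)),
        q (CurveClass.map (conjLIE.toHomeomorph : C(ℂ, ℂ)) γ) := by
  rw [measurableEmbedding_curveClassMap_conj.ae_map_iff]

/-- The transport is an involution. [folklore] -/
theorem conjTransport_conjTransport (P : ChordalFamily) (D : DobrushinDomain) :
    ((P ((D.map conjLIE.toHomeomorph).map conjLIE.toHomeomorph)).map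
        (CurveClass.map (conjLIE.toHomeomorph : C(ℂ, ℂ)))).map
          (CurveClass.map (conjLIE.toHomeomorph : C(ℂ, ℂ))) = P D := by
  rw [markedDomain_map_conj_map_conj,
    Measure.map_map measurable_curveClassMap_conj measurable_curveClassMap_conj]
  have : CurveClass.map (conjLIE.toHomeomorph : C(ℂ, ℂ)) ∘
      CurveClass.map (conjLIE.toHomeomorph : C(ℂ, ℂ)) = id :=
    funext curveClassMap_conj_conj
  rw [this, Measure.map_id]

/-- Transport of chordality. [folklore] -/
theorem isChordal_conjTransport {P : ChordalFamily} (h : P.IsChordal) :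
    ChordalFamily.IsChordal
      (fun D : DobrushinDomain => (P (D.map conjLIE.toHomeomorph)).map
        (CurveClass.map (conjLIE.toHomeomorph : C(ℂ, ℂ)))) := by
  intro D
  obtain ⟨hprob, hae⟩ := h (D.map conjLIE.toHomeomorph)
  refine ⟨⟨by rw [conjTransport_apply, Set.preimage_univ, measure_univ]⟩, ?_⟩
  rw [ae_conjTransport_iff]
  filter_upwards [hae] with x hx
  obtain ⟨hs, ht, hr⟩ := hx
  refine ⟨?_, ?_, ?_⟩
  · rw [CurveClass.source_map, hs, MarkedDomain.pt_map]
    exact conj_conj _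
  · rw [CurveClass.target_map, ht, MarkedDomain.pt_map]
    exact conj_conj _
  · rw [CurveClass.range_map]
    refine (Set.image_mono hr).trans ?_
    change conjLIE.toHomeomorph '' closure ((D.map conjLIE.toHomeomorph).carrier) ⊆ _
    rw [conjLIE.toHomeomorph.image_closure, MarkedDomain.carrier_map, conjH_image_image]

/-- Transport of the non-tracing clause (frontiers are transported by the homeomorphism
`conj`). [folklore] -/
theorem nonTracing_conjTransport {P : ChordalFamily}
    (h : ∀ D : DobrushinDomain, ∀ᵐ γ ∂(P D), ∀ c : Curve ℂ, CurveClass.mk c = γ →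
      ∀ s t : unitInterval, s < t → c '' Set.Icc s t ⊆ frontier D.carrier →
        (c '' Set.Icc s t).Subsingleton) :
    ∀ D : DobrushinDomain, ∀ᵐ γ ∂((P (D.map conjLIE.toHomeomorph)).map
      (CurveClass.map (conjLIE.toHomeomorph : C(ℂ, ℂ)))), ∀ c : Curve ℂ, CurveClass.mk c = γ →
      ∀ s t : unitInterval, s < t → c '' Set.Icc s t ⊆ frontier D.carrier →
        (c '' Set.Icc s t).Subsingleton := by
  intro D
  rw [ae_conjTransport_iff]
  filter_upwards [h (D.map conjLIE.toHomeomorph)] with x hx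
  intro c hc s t hst hsub
  have hc' : CurveClass.mk (c.map (conjLIE.toHomeomorph : C(ℂ, ℂ))) = x := by
    rw [← CurveClass.map_mk, hc, curveClassMap_conj_conj]
  have himage : (c.map (conjLIE.toHomeomorph : C(ℂ, ℂ))) '' Set.Icc s t =
      conjLIE.toHomeomorph '' (c '' Set.Icc s t) := by
    rw [Set.image_image]
    rfl
  have h1 := hx _ hc' s t hst (by
    rw [himage, MarkedDomain.carrier_map, ← conjLIE.toHomeomorph.image_frontier]
    exact Set.image_mono hsub)
  rw [himage] at h1
  exact Set.subsingleton_of_image conjLIE.toHomeomorph.injective _ h1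

/-- Transport of similarity covariance (only orientation-preserving similarities are needed on
either side: `conj ∘ (cz + w) ∘ conj = c̄ z + w̄`). [folklore] -/
theorem isSimilarityCovariant_conjTransport {P : ChordalFamily} (h : P.IsSimilarityCovariant) :
    ChordalFamily.IsSimilarityCovariant
      (fun D : DobrushinDomain => (P (D.map conjLIE.toHomeomorph)).map
        (CurveClass.map (conjLIE.toHomeomorph : C(ℂ, ℂ)))) := by
  intro D c hc w
  have hc' : conj c ≠ 0 := (map_ne_zero_iff _ (RingHom.injective _)).2 hc
  have hD : (D.map (similarity c hc w)).map conjLIE.toHomeomorph =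
      (D.map conjLIE.toHomeomorph).map (similarity (conj c) hc' (conj w)) := by
    rw [MarkedDomain.map_map, MarkedDomain.map_map, similarity_trans_conj]
  change (P ((D.map (similarity c hc w)).map conjLIE.toHomeomorph)).map
      (CurveClass.map (conjLIE.toHomeomorph : C(ℂ, ℂ))) =
    ((P (D.map conjLIE.toHomeomorph)).map (CurveClass.map (conjLIE.toHomeomorph : C(ℂ, ℂ)))).map
      (CurveClass.map (similarity c hc w : C(ℂ, ℂ)))
  rw [hD, h (D.map conjLIE.toHomeomorph) (conj c) hc' (conj w),
    Measure.map_map measurable_curveClassMap_conj (measurable_curveClassMap_similarity _ hc' _),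
    Measure.map_map (measurable_curveClassMap_similarity _ hc _) measurable_curveClassMap_conj]
  congr 1
  funext x
  obtain ⟨γ, rfl⟩ := CurveClass.surjective_mk x
  simp only [Function.comp_apply, CurveClass.map_mk]
  congr 1
  exact Curve.ext (ContinuousMap.ext fun t => by simp [conjLIE_toHomeomorph_apply])

/-- Transport of restriction locality. [folklore] -/
theorem isLocal_conjTransport {P : ChordalFamily} (h : P.IsLocal) :
    ChordalFamily.IsLocal
      (fun D : DobrushinDomain => (P (D.map conjLIE.toHomeomorph)).map
        (CurveClass.map (conjLIE.toHomeomorph : C(ℂ, ℂ)))) := by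
  intro D D' hsub h0 h1 T hT
  have hF : IsClosed (closure (D.carrier \ D'.carrier)) := isClosed_closure
  rw [conjTransport_apply, conjTransport_apply, curveClassMap_conj_preimage_stopAt hF]
  have hF' : conjLIE.toHomeomorph ⁻¹' closure (D.carrier \ D'.carrier) =
      closure ((D.map conjLIE.toHomeomorph).carrier \
        (D'.map conjLIE.toHomeomorph).carrier) := by
    rw [conjH_preimage, conjLIE.toHomeomorph.image_closure, MarkedDomain.carrier_map,
      MarkedDomain.carrier_map, Set.image_sdiff conjLIE.toHomeomorph.injective]
  rw [hF']
  exact h (D.map conjLIE.toHomeomorph) (D'.map conjLIE.toHomeomorph) (Set.image_mono hsub)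
    (by simp [h0]) (by simp [h1]) _ (hT.preimage measurable_curveClassMap_conj)

/-- Transport of splitting locality / target independence. [folklore] -/
theorem isTargetIndependent_conjTransport {P : ChordalFamily} (h : P.IsTargetIndependent) :
    ChordalFamily.IsTargetIndependent
      (fun D : DobrushinDomain => (P (D.map conjLIE.toHomeomorph)).map
        (CurveClass.map (conjLIE.toHomeomorph : C(ℂ, ℂ)))) := by
  intro D T hT
  rw [conjTransport_apply, conjTransport_apply,
    curveClassMap_conj_preimage_stopAt (D.isClosed_arc 1)]
  have harc : conjLIE.toHomeomorph ⁻¹' D.arc 1 = (D.map conjLIE.toHomeomorph).arc 1 := by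
    rw [MarkedDomain.arc_map, conjH_preimage]
  rw [harc, ← markedDomain_chord_map, ← markedDomain_chord_map]
  exact h (D.map conjLIE.toHomeomorph) _ (hT.preimage measurable_curveClassMap_conj)

/-- Transport of the domain Markov property, with kernel
`Q̄ D p := conj_* Q (conj D) (conj p)`. [folklore] -/
theorem isDomainMarkov_conjTransport {P : ChordalFamily} (h : P.IsDomainMarkov) :
    ChordalFamily.IsDomainMarkov
      (fun D : DobrushinDomain => (P (D.map conjLIE.toHomeomorph)).map
        (CurveClass.map (conjLIE.toHomeomorph : C(ℂ, ℂ)))) := by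
  obtain ⟨Q, hQ⟩ := h
  refine ⟨fun D p => (Q (D.map conjLIE.toHomeomorph)
    (CurveClass.map (conjLIE.toHomeomorph : C(ℂ, ℂ)) p)).map
      (CurveClass.map (conjLIE.toHomeomorph : C(ℂ, ℂ))), ?_, ?_, ?_⟩
  · intro D
    change (Q (D.map conjLIE.toHomeomorph) (CurveClass.map (conjLIE.toHomeomorph : C(ℂ, ℂ))
        (CurveClass.mk (Curve.const (D.pt 0))))).map
          (CurveClass.map (conjLIE.toHomeomorph : C(ℂ, ℂ))) =
      (P (D.map conjLIE.toHomeomorph)).map (CurveClass.map (conjLIE.toHomeomorph : C(ℂ, ℂ)))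
    have hc : CurveClass.map (conjLIE.toHomeomorph : C(ℂ, ℂ))
        (CurveClass.mk (Curve.const (D.pt 0))) =
          CurveClass.mk (Curve.const ((D.map conjLIE.toHomeomorph).pt 0)) := by
      rw [CurveClass.map_mk, MarkedDomain.pt_map]
      rfl
    rw [hc, hQ.initial]
  · intro D F hF S T hS hT
    have hF' : IsClosed (conjLIE.toHomeomorph ⁻¹' F) :=
      hF.preimage conjLIE.toHomeomorph.continuous
    rw [conjTransport_apply, Set.preimage_inter, curveClassMap_conj_preimage_stopAt hF,
      curveClassMap_conj_preimage_startFrom hF,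
      hQ.markov (D.map conjLIE.toHomeomorph) _ hF' _ _
        (hS.preimage measurable_curveClassMap_conj) (hT.preimage measurable_curveClassMap_conj)]
    change _ = ∫⁻ γ in CurveClass.stopAt F ⁻¹' S,
      (Q (D.map conjLIE.toHomeomorph)
        (CurveClass.map (conjLIE.toHomeomorph : C(ℂ, ℂ)) (CurveClass.stopAt F γ))).map
          (CurveClass.map (conjLIE.toHomeomorph : C(ℂ, ℂ))) T
        ∂((P (D.map conjLIE.toHomeomorph)).map (CurveClass.map (conjLIE.toHomeomorph : C(ℂ, ℂ))))
    rw [measurableEmbedding_curveClassMap_conj.restrict_map,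
      measurableEmbedding_curveClassMap_conj.lintegral_map, curveClassMap_conj_preimage_stopAt hF]
    refine lintegral_congr fun γ => ?_
    rw [measurableEmbedding_curveClassMap_conj.map_apply, curveClass_stopAt_map _ hF,
      curveClassMap_conj_conj]
    rfl
  · intro D₁ D₂ p₁ p₂ hrem htip hb
    rw [hQ.domain (D₁.map conjLIE.toHomeomorph) (D₂.map conjLIE.toHomeomorph)
      (CurveClass.map (conjLIE.toHomeomorph : C(ℂ, ℂ)) p₁)
      (CurveClass.map (conjLIE.toHomeomorph : C(ℂ, ℂ)) p₂)
      (by rw [remainingDomain_map, remainingDomain_map, hrem])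
      (by rw [CurveClass.target_map, CurveClass.target_map, htip])
      (by rw [MarkedDomain.pt_map, MarkedDomain.pt_map, hb])]

/-- **The mirror image of an admissible family is admissible.** [folklore] -/
theorem isLocalMarkovChordalFamily_conjTransport {P : ChordalFamily}
    (h : IsLocalMarkovChordalFamily P) : IsLocalMarkovChordalFamily
      (fun D : DobrushinDomain => (P (D.map conjLIE.toHomeomorph)).map
        (CurveClass.map (conjLIE.toHomeomorph : C(ℂ, ℂ)))) where
  isChordal := isChordal_conjTransport h.isChordal
  similarity := isSimilarityCovariant_conjTransport h.similarity
  markov := isDomainMarkov_conjTransport h.markov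
  isLocal := isLocal_conjTransport h.isLocal
  targetIndependent := isTargetIndependent_conjTransport h.targetIndependent

/-! ### Consequences of the crux -/

/-- **Crux ⇒ achirality.** Under the crux every admissible (bundle + non-tracing) family equals
its mirror image, although the hypothesis bundle contains no orientation-reversing symmetry.
[folklore] -/
theorem conjTransport_eq_of_crux (hcrux : CardyRotToConfR2SymmetryUpgrade) {P : ChordalFamily}
    (hP : IsLocalMarkovChordalFamily P)
    (n : ∀ D : DobrushinDomain, ∀ᵐ γ ∂(P D), ∀ c : Curve ℂ, CurveClass.mk c = γ →
      ∀ s t : unitInterval, s < t → c '' Set.Icc s t ⊆ frontier D.carrier →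
        (c '' Set.Icc s t).Subsingleton) :
    (fun D : DobrushinDomain => (P (D.map conjLIE.toHomeomorph)).map
        (CurveClass.map (conjLIE.toHomeomorph : C(ℂ, ℂ)))) = P :=
  funext fun D => eq_of_crux hcrux (isLocalMarkovChordalFamily_conjTransport hP)
    (nonTracing_conjTransport n) hP n D

/-- **Crux ⇒ reflection covariance** in the form of the conjugation clause of
`ChordalFamily.IsLatticeSimilarityCovariant`: `P (conj D) = conj_* (P D)` for every admissible
family and every Dobrushin domain. [folklore] -/
theorem conj_covariant_of_crux (hcrux : CardyRotToConfR2SymmetryUpgrade) {P : ChordalFamily}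
    (hP : IsLocalMarkovChordalFamily P)
    (n : ∀ D : DobrushinDomain, ∀ᵐ γ ∂(P D), ∀ c : Curve ℂ, CurveClass.mk c = γ →
      ∀ s t : unitInterval, s < t → c '' Set.Icc s t ⊆ frontier D.carrier →
        (c '' Set.Icc s t).Subsingleton)
    (D : DobrushinDomain) :
    P (D.map conjLIE.toHomeomorph) =
      (P D).map (CurveClass.map (conjLIE.toHomeomorph : C(ℂ, ℂ))) := by
  have h := congrFun (conjTransport_eq_of_crux hcrux hP n) (D.map conjLIE.toHomeomorph)
  simp only [markedDomain_map_conj_map_conj] at h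
  exact h.symm

/-- Under the crux every admissible family is lattice-similarity covariant INCLUDING the
orientation-reversing clause (`IsLatticeSimilarityCovariant`). [folklore] -/
theorem isLatticeSimilarityCovariant_of_crux (hcrux : CardyRotToConfR2SymmetryUpgrade)
    {P : ChordalFamily} (hP : IsLocalMarkovChordalFamily P)
    (n : ∀ D : DobrushinDomain, ∀ᵐ γ ∂(P D), ∀ c : Curve ℂ, CurveClass.mk c = γ →
      ∀ s t : unitInterval, s < t → c '' Set.Icc s t ⊆ frontier D.carrier →
        (c '' Set.Icc s t).Subsingleton) :
    P.IsLatticeSimilarityCovariant :=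
  hP.similarity.isLatticeSimilarityCovariant fun D => conj_covariant_of_crux hcrux hP n D

/-- **Chirality template.** ONE admissible family which differs from its mirror image on ONE
Dobrushin domain refutes the crux — no second family, no fact about SLE₆. [folklore] -/
theorem not_crux_of_chiral {P : ChordalFamily} (hP : IsLocalMarkovChordalFamily P)
    (n : ∀ D : DobrushinDomain, ∀ᵐ γ ∂(P D), ∀ c : Curve ℂ, CurveClass.mk c = γ →
      ∀ s t : unitInterval, s < t → c '' Set.Icc s t ⊆ frontier D.carrier →
        (c '' Set.Icc s t).Subsingleton)
    {D : DobrushinDomain}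
    (hne : (P (D.map conjLIE.toHomeomorph)).map
      (CurveClass.map (conjLIE.toHomeomorph : C(ℂ, ℂ))) ≠ P D) :
    ¬ CardyRotToConfR2SymmetryUpgrade :=
  fun h => hne (congrFun (conjTransport_eq_of_crux h hP n) D)

/-- The same template in the `IsLatticeSimilarityCovariant` vocabulary: an admissible family
violating the conjugation clause on one domain refutes the crux. [folklore] -/
theorem not_crux_of_not_conj_covariant {P : ChordalFamily} (hP : IsLocalMarkovChordalFamily P)
    (n : ∀ D : DobrushinDomain, ∀ᵐ γ ∂(P D), ∀ c : Curve ℂ, CurveClass.mk c = γ →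
      ∀ s t : unitInterval, s < t → c '' Set.Icc s t ⊆ frontier D.carrier →
        (c '' Set.Icc s t).Subsingleton)
    {D : DobrushinDomain}
    (hne : P (D.map conjLIE.toHomeomorph) ≠
      (P D).map (CurveClass.map (conjLIE.toHomeomorph : C(ℂ, ℂ)))) :
    ¬ CardyRotToConfR2SymmetryUpgrade :=
  fun h => hne (conj_covariant_of_crux h hP n D)

end Summit.CriticalPhenomena.CardyFormulaZ2.Theorems.CardyRotToConfR2SymmetryUpgrade.Negative
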